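import Summits.QuantumFields.YangMills.Theorems.DiagonalMirrorRPRWilsonDiagonalModelOpenBlock

/-!
# Crux `WeakCouplingHypercubicLimitRP` (stmt-QuantumFields-27398) / aside `DiagonalMirrorRPR` (⟨10604⟩), door B, construction F1_diag —
# PAIRING LAYER, step P3c′: regularity of the open-block kernel; bounded-measurable Fubini helpers

Helper file (`--supports stmt-QuantumFields-27398 --as helper`) of `hand-10604-wilsonDiagModel-3` (director-ym g23, R695/R701-ym, O4 WORD 30:
step P3 of hand-1's ROADMAP-F1diag v4 §1⅞ / hand-2's addendum v5); it closes nothing by itself.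

* `measurable_integral_of_bdd`, `abs_integral_le_of_bdd`, `integral_integral_swap_of_bdd` — parametric integrals of bounded jointly measurable
  functions over finite measures are measurable and bounded, and two such integrations commute (the only analysis used when the lifted
  cycle is cut into blocks, `…BlockSplit`);
* `measurable_openBlock`, `abs_openBlock_le` — the dressed open-block kernel `openBlock Jb` (`…OpenBlock`) is jointly measurable and bounded
  (so it defines a bounded integral operator on `L²(μ̃)`, `…Sandwich`);
* `integral_integral_blockFun'` — the cut variables integrate to the open-block kernel in the OTHER order (`∫ dZ ∫ dy`).

HONEST FRAMING: bookkeeping only; `wilsonDiagonalModel` is NOT landed here; no letter is proved; D1, ⟨27398⟩, S6i, ⟨10604⟩ are OPEN; nothing here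
bears on the summit; the Yang–Mills mass gap is NOT proved here or anywhere in the tree.  No definition, no instance, no notation.
-/

set_option autoImplicit false

noncomputable section

open scoped BigOperators ENNReal
open MeasureTheory Function Filter
open Literature.MathematicalPhysics.QuantumLattice Literature.MathematicalPhysics.QuantumFieldTheory
open Summit.QuantumFields.YangMills.Cruxes.DiagonalMirrorRPR.ParityBridgeColdTraces

namespace Summit.QuantumFields.YangMills.Cruxes.DiagonalMirrorRPR.SignTwistedDiagonalTrace.WilsonDiagonal

/-! ## §1 Bounded measurable Fubini helpers -/

section Bdd

variable {α β : Type*} [MeasurableSpace α] [MeasurableSpace β] {ν : Measure β}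

/-- A parametric integral of a bounded jointly measurable function is measurable. -/
theorem measurable_integral_of_bdd [SFinite ν] {Φ : α × β → ℝ} (hΦ : Measurable Φ) :
    Measurable fun a => ∫ b, Φ (a, b) ∂ν :=
  (hΦ.stronglyMeasurable.integral_prod_right' (ν := ν)).measurable

omit [MeasurableSpace α] in
/-- … and bounded by `C · ν(univ)`. -/
theorem abs_integral_le_of_bdd [IsFiniteMeasure ν] {Φ : α × β → ℝ} {C : ℝ} (hC : ∀ p, |Φ p| ≤ C) (a : α) :
    |∫ b, Φ (a, b) ∂ν| ≤ C * ν.real Set.univ := by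
  rw [← Real.norm_eq_abs]
  exact norm_integral_le_of_norm_le_const (ae_of_all _ fun b => by simpa only [Real.norm_eq_abs] using hC (a, b))

/-- **Two bounded measurable integrations over finite measures commute.** -/
theorem integral_integral_swap_of_bdd {μ : Measure α} [IsFiniteMeasure μ] [IsFiniteMeasure ν] {f : α → β → ℝ}
    (hf : Measurable (uncurry f)) {C : ℝ} (hC : ∀ a b, |f a b| ≤ C) :
    ∫ a, ∫ b, f a b ∂ν ∂μ = ∫ b, ∫ a, f a b ∂μ ∂ν :=
  integral_integral_swap (Integrable.of_bound hf.aestronglyMeasurable C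
    (ae_of_all _ fun p => by simpa only [Real.norm_eq_abs, uncurry] using hC p.1 p.2))

end Bdd

/-! ## §2 Regularity of the open-block kernel -/

section OpenBlockKernel

variable {S : ℕ} [NeZero S] {G : Type} [Group G] {Nc : ℕ} (ρ : G →* Matrix (Fin Nc) (Fin Nc) ℂ)
variable [TopologicalSpace G] [IsTopologicalGroup G] [CompactSpace G] [MeasurableSpace G] [BorelSpace G]
  [SecondCountableTopology G]

/-- The open-block kernel is jointly measurable in its end states. -/
theorem measurable_openBlock (hρ : Continuous ρ) {β : ℝ} (hβ : 0 ≤ β) (M : ℝ) {e : ℕ}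
    {Jb : (Fin (e + 1) → HalfCfg S S G) → (Fin (e + 2) → ℕ × HalfCfg S S G) → ℝ} (hJb : Measurable (uncurry Jb)) :
    Measurable (uncurry (openBlock (Nc := Nc) ρ β M Jb)) := by
  haveI := isFiniteMeasure_tMeasure (S := S) (G := G) (Nc := Nc) hβ M
  haveI : IsProbabilityMeasure (halfHaar S G) := by unfold halfHaar; infer_instance
  -- the integrand as a function of `(((a, b), Zv), Y)`
  have hV : Measurable fun r : (((ℕ × HalfCfg S S G) × (ℕ × HalfCfg S S G)) × (Fin e → ℕ × HalfCfg S S G)) ×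
      (Fin (e + 1) → HalfCfg S S G) => (Fin.cons r.1.1.1 (Fin.snoc r.1.2 r.1.1.2) : Fin (e + 2) → ℕ × HalfCfg S S G) :=
    (Literature.Analysis.OperatorTheory.measurable_finCons (e + 1)).comp (measurable_fst.fst.fst.prodMk
      ((Literature.Analysis.OperatorTheory.measurable_finSnoc e).comp (measurable_fst.snd.prodMk measurable_fst.fst.snd)))
  have h3 : Measurable fun r : (((ℕ × HalfCfg S S G) × (ℕ × HalfCfg S S G)) × (Fin e → ℕ × HalfCfg S S G)) ×
      (Fin (e + 1) → HalfCfg S S G) => Jb r.2 (Fin.cons r.1.1.1 (Fin.snoc r.1.2 r.1.1.2)) *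
      ∏ j : Fin (e + 1), linkKer ρ β M ((Fin.cons r.1.1.1 (Fin.snoc r.1.2 r.1.1.2) : Fin (e + 2) → ℕ × HalfCfg S S G) j.castSucc)
        (r.2 j) ((Fin.cons r.1.1.1 (Fin.snoc r.1.2 r.1.1.2) : Fin (e + 2) → ℕ × HalfCfg S S G) j.succ) := by
    have h := measurable_blockIntegrand ρ hρ β M hJb measurable_snd hV
    exact h
  have h2 : Measurable fun q : ((ℕ × HalfCfg S S G) × (ℕ × HalfCfg S S G)) × (Fin e → ℕ × HalfCfg S S G) =>
      ∫ Y : Fin (e + 1) → HalfCfg S S G, Jb Y (Fin.cons q.1.1 (Fin.snoc q.2 q.1.2)) *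
        ∏ j : Fin (e + 1), linkKer ρ β M ((Fin.cons q.1.1 (Fin.snoc q.2 q.1.2) : Fin (e + 2) → ℕ × HalfCfg S S G) j.castSucc)
          (Y j) ((Fin.cons q.1.1 (Fin.snoc q.2 q.1.2) : Fin (e + 2) → ℕ × HalfCfg S S G) j.succ)
        ∂(Measure.pi fun _ => halfHaar S G) := by
    have h := h3.stronglyMeasurable.integral_prod_right' (ν := Measure.pi fun _ : Fin (e + 1) => halfHaar S G)
    exact h.measurable
  have h1 := h2.stronglyMeasurable.integral_prod_right' (ν := Measure.pi fun _ : Fin e => tMeasure S G Nc β M)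
  exact h1.measurable

omit [SecondCountableTopology G] in
/-- The open-block kernel is bounded. -/
theorem abs_openBlock_le (hρ : Continuous ρ) {β : ℝ} (hβ : 0 ≤ β) {M : ℝ}
    (hM : ∀ (Y : HalfCfg S S G) (j : Fin (featDim S Nc)), |bondVec ρ Y j| ≤ M) {e : ℕ}
    {Jb : (Fin (e + 1) → HalfCfg S S G) → (Fin (e + 2) → ℕ × HalfCfg S S G) → ℝ} {B : ℝ} (hB : ∀ Y V, |Jb Y V| ≤ B) :
    ∃ CB : ℝ, ∀ a b : ℕ × HalfCfg S S G, |openBlock (Nc := Nc) ρ β M Jb a b| ≤ CB := by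
  haveI := isFiniteMeasure_tMeasure (S := S) (G := G) (Nc := Nc) hβ M
  haveI : IsProbabilityMeasure (halfHaar S G) := by unfold halfHaar; infer_instance
  obtain ⟨C, _, hC⟩ := exists_abs_linkKer_le (S := S) ρ hρ β hM
  refine ⟨B * C ^ (e + 1) * 1 * (Measure.pi fun _ : Fin e => tMeasure S G Nc β M).real Set.univ, fun a b => ?_⟩
  unfold openBlock
  rw [← Real.norm_eq_abs]
  refine norm_integral_le_of_norm_le_const (ae_of_all _ fun Zv => ?_)
  haveI : IsProbabilityMeasure (Measure.pi fun _ : Fin (e + 1) => halfHaar S G) := by infer_instance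
  have h := norm_integral_le_of_norm_le_const (μ := Measure.pi fun _ : Fin (e + 1) => halfHaar S G)
    (f := fun Y : Fin (e + 1) → HalfCfg S S G => Jb Y (Fin.cons a (Fin.snoc Zv b)) *
      ∏ j : Fin (e + 1), linkKer ρ β M ((Fin.cons a (Fin.snoc Zv b) : Fin (e + 2) → ℕ × HalfCfg S S G) j.castSucc)
        (Y j) ((Fin.cons a (Fin.snoc Zv b) : Fin (e + 2) → ℕ × HalfCfg S S G) j.succ)) (C := B * C ^ (e + 1))
    (ae_of_all _ fun Y => ?_)
  · simpa only [probReal_univ] using h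
  · have h := abs_blockFun_le ρ hB hC a (fun j => (Zv j, Y j.castSucc)) (b, Y (Fin.last e))
    unfold blockFun at h
    have hY : (Fin.snoc (fun j : Fin e => Y j.castSucc) (Y (Fin.last e)) : Fin (e + 1) → HalfCfg S S G) = Y :=
      Fin.snoc_init_self Y
    dsimp only at h
    rw [hY] at h
    rwa [Real.norm_eq_abs]

/-- **The cut variables integrate to the open-block kernel, interior first**: `∫ (∫ blockFun Jb a Z (b, y) dy) dZ = openBlock Jb a b`. -/
theorem integral_integral_blockFun' (hρ : Continuous ρ) {β : ℝ} (hβ : 0 ≤ β) {M : ℝ}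
    (hM : ∀ (Y : HalfCfg S S G) (j : Fin (featDim S Nc)), |bondVec ρ Y j| ≤ M) {e : ℕ}
    {Jb : (Fin (e + 1) → HalfCfg S S G) → (Fin (e + 2) → ℕ × HalfCfg S S G) → ℝ} (hJb : Measurable (uncurry Jb))
    {B : ℝ} (hB : ∀ Y V, |Jb Y V| ≤ B) (a b : ℕ × HalfCfg S S G) :
    ∫ Z : Fin e → (ℕ × HalfCfg S S G) × HalfCfg S S G, ∫ y, blockFun ρ β M Jb a Z (b, y) ∂(halfHaar S G)
        ∂(Measure.pi fun _ => (tMeasure S G Nc β M).prod (halfHaar S G)) =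
      openBlock (Nc := Nc) ρ β M Jb a b := by
  haveI : IsProbabilityMeasure (halfHaar S G) := by unfold halfHaar; infer_instance
  haveI := isFiniteMeasure_tMeasure (S := S) (G := G) (Nc := Nc) hβ M
  obtain ⟨C, _, hC⟩ := exists_abs_linkKer_le (S := S) ρ hρ β hM
  rw [← integral_integral_blockFun ρ hρ hβ hM hJb hB a b]
  refine integral_integral_swap_of_bdd (C := B * C ^ (e + 1)) ?_ (fun Z y => abs_blockFun_le ρ hB hC a Z (b, y))
  exact (measurable_blockFun ρ hρ β M hJb).comp (measurable_const.prodMk (measurable_fst.prodMk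
    (measurable_const.prodMk measurable_snd)))

end OpenBlockKernel

end Summit.QuantumFields.YangMills.Cruxes.DiagonalMirrorRPR.SignTwistedDiagonalTrace.WilsonDiagonal

end
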